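import Summits.QuantumFields.Balaban3D.Carriers.Histories

/-! gen-6 negation/compatibility check (ym-cruxidea-18916-2): with the typer's repair R1 of 2‴ (w2)
(`1 ≤ j →` added), the 4a-of-record binder `j ≤ K → r ≠ trivReg K j → …` is still fed, because a
non-trivial history exists only at levels `j ≥ 1` (`Hist P 0` is `Unique`). -/

open Summit.QuantumFields.Balaban3D.Carriers
open Literature.MathematicalPhysics.QuantumFieldTheory.Balaban1983to89

theorem one_le_of_ne_triv (P : Params) (j : ℕ) (r : Hist P j) (hr : r ≠ Hist.triv P j) : 1 ≤ j := by
  rcases Nat.eq_zero_or_pos j with rfl | h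
  · exact absurd (Subsingleton.elim r _) hr
  · exact h

/-- the shim in the shape the composition `perPlaquetteHigh_lane` would use: an R1-shaped (w2)
yields the old-shaped (w2) restricted to `r ≠ triv`. -/
theorem w2_old_of_R1 {P : Params} {β : (K j : ℕ) → Hist P j → Prop}
    (hR1 : ∀ K j (r : Hist P j), j ≤ K → 1 ≤ j → β K j r) :
    ∀ K j (r : Hist P j), j ≤ K → r ≠ Hist.triv P j → β K j r :=
  fun K j r hjK hr => hR1 K j r hjK (one_le_of_ne_triv P j r hr)
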